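import Literature.NumberTheory.EllipticCurves.ModularJacobianNeronDifferentials
import Literature.NumberTheory.EllipticCurves.ModularCurvePeriodRatioTwoProofs
import HarnessLib

/-!
# Mazur's Cor. 4.1, Abbes–Ullmo's Thm. A and Raynaud's letter from the lattice of Néron
# differentials (proofs only)

Topic `NumberTheory/EllipticCurves`; namespace `Literature.NumberTheory.EllipticCurves.ModularForms`.
Proofs-only companion (theorems only: no definition, no named fact; D-0026) of
`ModularJacobianNeronDifferentials.lean` (the hypothesis structure `NeronFormsAt N p` =
`Λ = H⁰(𝒥₀(N)_{ℤ_(p)}, Ω¹) ⊂ S₂(Γ₀(N))` with its printed properties, and the named fact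
`nonempty_neronFormsAt`). It derives, by the printed roads and with every step kernel-checked,
the three Manin-constant inputs of the BSD wall that live over `Spec ℤ[1/m]`:

* §1 `NeronFormsAt.intCast_smul_f_mem_of_dvd` — one turn of the `q`-expansion crank: if
  `z·f ∈ Λ` with `p ∣ z` then `(z/p)·f ∈ Λ` (`qExpansionPrinciple` applied to the `w_N`-eigenvector
  `z f`, `aₙ(f) ∈ ℤ`); `NeronFormsAt.not_dvd_maninConstant_of_saturated` — saturation of
  `ℤ_(p) c f` in `Λ` and `c f ∈ Λ` give `p ∤ c` (Mazur's "immediate corollary", p. 144).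
* §2 **Mazur 1978 Cor. 4.1** — `mazur_not_dvd_maninConstant_of_odd_of_neronFormsAt :
  nonempty_neronFormsAt → mazur_not_dvd_maninConstant_of_odd` (fields `maninConstant_smul_mem`,
  `qExpansionPrinciple`, `saturated_of_odd` = Cor. 1.1), and its corollary at odd `p ∤ N`
  (Abbes–Ullmo p. 269: "Pour `p > 2`, le Théorème A est contenu dans les travaux de Mazur").
* §3 **Abbes–Ullmo 1996 Thm. A** —
  `abbesUllmo_not_dvd_maninConstant_of_not_dvd_level_of_ribet_of_neronFormsAt` from
  `nonempty_neronFormsAt`, Ribet's `deg φ ∣ r` (tree fact `modularDegree_dvd_congruenceNumber`) and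
  the finiteness `r ≠ 0` of the congruence number (displayed, as in `CongruenceNumberProofs`),
  through `abbesUllmo_not_dvd_maninConstant_of_not_dvd_level_of_ribet_of_pullbackIntegral`
  (fields `mem_of_not_dvd_level` = §2.1 (2), `pullback_integral` = (6) p. 275); hence Per2
  (`realPeriodRat_eq_unit_mul_plusPeriod_two`) by
  `SkinnerUrban2014.realPeriodRat_eq_unit_mul_plusPeriod_two_fact_of_abbesUllmo`.
* §4 **Raynaud's letter** (Abbes–Ullmo Prop. 3.1 and Appendice): `v₂(c) ≤ 1` for lattice-optimal
  data at a level `N` with `4 ∤ N` (`padicValInt_two_maninConstant_le_one_of_neronFormsAt`, field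
  `half_saturated_two`), and `2 ∤ c` for strong Weil curves with good supersingular reduction at
  `2` (`maninConstant_odd_of_goodSupersingular_of_neronFormsAt`, field
  `saturated_two_of_supersingular`) — the displayed input `hMR` of
  `exists_unit_mul_plusPeriod_two_of_goodSupersingular_of_maninConstant_odd`, whence Per2's
  conclusion on the supersingular habitat WITHOUT Ribet's theorem
  (`exists_unit_mul_plusPeriod_two_of_goodSupersingular_of_neronFormsAt`).

HONESTY. Every theorem here is conditional on the named fact `nonempty_neronFormsAt` (a
hypothesis structure standing for the Néron-model cotangent lattice; see the collapse caveat in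
the companion's docstring: at `p ∤ N` the fields used in §2–§3 are the analytic shadows of
Mazur's Cor. 1.1 and of Abbes–Ullmo's (6), equivalent there to the conclusions they feed).
Nothing is discharged; `mazur_not_dvd_maninConstant_of_odd`,
`abbesUllmo_not_dvd_maninConstant_of_not_dvd_level` and `realPeriodRat_eq_unit_mul_plusPeriod_two`
remain named facts; no summit statement is proved; BSD is not advanced by this file.

## References

* B. Mazur, *Rational isogenies of prime degree*, Invent. Math. 44 (1978): Cor. 1.1 (p. 137),
  §2e (pp. 140–141), Prop. 3.1 (pp. 142–143), Cor. 4.1 (p. 144). [Mazur1978]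
* A. Abbes, E. Ullmo, *À propos de la conjecture de Manin pour les courbes elliptiques modulaires*,
  Compositio Math. 103 (1996): §2.1, §3 (Prop. 3.1, Lemme 3.1, (6), Prop. 3.3–3.4, Lemme 3.2,
  Preuve du Thm. A), Appendice Thm. A.1, Cor. A.4. [AbbesUllmo1996]
* A. Agashe, K. A. Ribet, W. A. Stein, *The modular degree, congruence primes, and multiplicity
  one* (2012), Thm. 2.1. [AgasheRibetStein2012]
-/

noncomputable section

open scoped MatrixGroups ModularForm

open CongruenceSubgroup UpperHalfPlane

namespace Literature.NumberTheory.EllipticCurves.ModularForms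

/-! ### §0 Fourier coefficients of scalar multiples -/

/-- `aₙ(a • f) = a · aₙ(f)` on `S_k(Γ₀(N))` (Mathlib `qExpansion_smul`; `S₂(R)` is an
`R`-module under the coefficientwise action, Abbes–Ullmo §2.1 "`B⁰(ℤ) ⊗ R = B⁰(R)`").
[cite: AbbesUllmo1996, §2.1 (p. 271)] -/
theorem cuspCoeff_const_smul {N : ℕ} {k : ℤ} (a : ℂ) (f : CuspForm (Gamma0 N) k) (n : ℕ) :
    cuspCoeff (a • f) n = a * cuspCoeff f n := by
  have hΓ : (1 : ℝ) ∈ (Gamma0 N : Subgroup (GL (Fin 2) ℝ)).strictPeriods :=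
    one_mem_strictPeriods_coe_gamma0 N
  have han : AnalyticAt ℂ (cuspFunction 1 ⇑f) 0 :=
    ModularFormClass.analyticAt_cuspFunction_zero f one_pos hΓ
  change (qExpansion 1 ⇑(a • f)).coeff n = a * (qExpansion 1 ⇑f).coeff n
  rw [CuspForm.IsGLPos.coe_smul, qExpansion_smul han]
  simp [smul_eq_mul]

namespace NeronFormsAt

variable {N : ℕ} [NeZero N] {p : ℕ} (Λ : NeronFormsAt N p)

/-! ### §1 The `q`-expansion crank and the saturation step -/

/-- **One turn of the `q`-expansion crank.** If `z·f ∈ Λ` for the newform `f = D.f` of a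
parametrisation datum (`aₙ(f) ∈ ℤ`, `w_N f = ±f`) and `p ∣ z`, then `(z/p)·f ∈ Λ`: the
`q`-expansion of `z f` vanishes mod `p` and `z f` is a `w_N`-eigenvector, so `z f ∈ pΛ` by
`qExpansionPrinciple` (Mazur 1978, proof of Prop. 3.1, p. 143; Abbes–Ullmo 1996, p. 274).
[cite: Mazur1978, Prop. 3.1 (pp. 142–143)] -/
theorem intCast_smul_f_mem_of_dvd (hp : p.Prime) {W : WeierstrassCurve ℚ}
    (D : ModularParametrizationData W N) {z : ℤ} (hz : (z : ℂ) • D.f ∈ Λ.lattice) (z' : ℤ)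
    (hzz' : z = p * z') : (z' : ℂ) • D.f ∈ Λ.lattice := by
  have hpC : (p : ℂ) ≠ 0 := Nat.cast_ne_zero.mpr hp.ne_zero
  -- `z f` is a Fricke eigenvector (newforms are, `IsNewform0.frickeInvolution_eq_smul_holds`)
  have hfr : ∃ ε : ℂ, frickeInvolution N 2 ((z : ℂ) • D.f) = ε • ((z : ℂ) • D.f) :=
    ⟨frickeEigenvalue D.f, by
      rw [map_smul, IsNewform0.frickeInvolution_eq_smul_holds D.isNewformOf.1, smul_comm]⟩
  -- its coefficients are `p · (z' aₙ(f))` with `z' aₙ(f) ∈ ℤ`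
  have hcoef : ∀ n : ℕ, ∃ t : ℚ, 0 ≤ padicValRat p t ∧
      ((p : ℂ) * (t : ℂ)) = cuspCoeff ((z : ℂ) • D.f) n := by
    intro n
    obtain ⟨a, ha⟩ := D.f_mem_integralCuspForms0 n
    refine ⟨((z' * a : ℤ) : ℚ), ?_, ?_⟩
    · rw [padicValRat.of_int]
      exact_mod_cast Nat.zero_le _
    · rw [cuspCoeff_const_smul, ← ha, hzz']
      push_cast
      ring
  have hmem := Λ.qExpansionPrinciple _ hz hfr hcoef
  have e : ((p : ℂ)⁻¹) • ((z : ℂ) • D.f) = (z' : ℂ) • D.f := by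
    rw [smul_smul, hzz']
    push_cast
    rw [inv_mul_cancel_left₀ hpC]
  rwa [e] at hmem

/-- **The saturation step** ("an immediate corollary of Proposition 3.1", Mazur p. 144). If
`c f ∈ Λ` and `ℚ f ∩ Λ = ℤ_(p) c f` (saturation, `hsat`), then `p ∤ c`: otherwise `(c/p) f ∈ Λ` by
the crank, and `c/p = t c` forces `t = 1/p ∉ ℤ_(p)`. [cite: Mazur1978, Cor. 4.1 (p. 144)] -/
theorem not_dvd_maninConstant_of_saturated (hp : p.Prime) {W : WeierstrassCurve ℚ}
    (D : ModularParametrizationData W N) (hcf : (D.maninConstant : ℂ) • D.f ∈ Λ.lattice)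
    (hsat : ∀ a : ℂ, a • D.f ∈ Λ.lattice →
      ∃ t : ℚ, 0 ≤ padicValRat p t ∧ a = (t : ℂ) * (D.maninConstant : ℂ)) :
    ¬ (p : ℤ) ∣ D.maninConstant := by
  haveI := Fact.mk hp
  rintro ⟨c', hc'⟩
  have hc0 : D.maninConstant ≠ 0 := D.maninConstant_ne_zero_holds
  have hc'0 : c' ≠ 0 := by
    rintro rfl
    exact hc0 (by rw [hc', mul_zero])
  have hmem : (c' : ℂ) • D.f ∈ Λ.lattice := Λ.intCast_smul_f_mem_of_dvd hp D hcf c' hc'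
  obtain ⟨t, ht, hct⟩ := hsat (c' : ℂ) hmem
  -- `c' = t · c = t · p · c'`, so `t p = 1`
  have htp : t * p = 1 := by
    have e1 : (c' : ℂ) = (t : ℂ) * (p : ℂ) * (c' : ℂ) := by
      calc (c' : ℂ) = (t : ℂ) * (D.maninConstant : ℂ) := hct
        _ = (t : ℂ) * (p : ℂ) * (c' : ℂ) := by rw [hc']; push_cast; ring
    have e2 : (c' : ℚ) = t * p * c' := by exact_mod_cast e1
    have hc'Q : (c' : ℚ) ≠ 0 := by exact_mod_cast hc'0
    exact mul_right_cancel₀ hc'Q ((one_mul (c' : ℚ)).trans e2).symm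
  -- valuation: `v_p(t) = -1 < 0`
  have htinv : t = (p : ℚ)⁻¹ := eq_inv_of_mul_eq_one_left htp
  rw [htinv, padicValRat.inv, padicValRat.self hp.one_lt] at ht
  omega

end NeronFormsAt

/-! ### §2 Mazur 1978, Cor. 4.1 -/

/-- **Mazur 1978, Cor. 4.1, from the lattice of Néron differentials.** For every globally minimal
`W'`, every lattice-optimal datum `D'` at level `N'`, every odd prime `p` with `p² ∤ N'`: `p ∤ c`
— from `c f ∈ Λ` (`maninConstant_smul_mem`), the `q`-expansion principle mod `p` for the
`w_N`-eigenvector `c f` (`qExpansionPrinciple`) and the saturation of `ℤ_(p) c f` in `Λ`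
(`saturated_of_odd` = Cor. 1.1): Mazur's road, Prop. 3.1 ⇒ Cor. 4.1. Conditional on the named
fact `nonempty_neronFormsAt`; nothing is discharged. [cite: Mazur1978, Cor. 1.1 (p. 137), Prop. 3.1 (pp. 142–143), Cor. 4.1 (p. 144)] -/
theorem mazur_not_dvd_maninConstant_of_odd_of_neronFormsAt (h : nonempty_neronFormsAt) :
    mazur_not_dvd_maninConstant_of_odd := by
  intro W' _ _ N' _ D' hopt p hp hp2 hpN
  obtain ⟨Λ⟩ := h N' p hp hpN
  exact Λ.not_dvd_maninConstant_of_saturated hp D' (Λ.maninConstant_smul_mem W' D' hopt)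
    (Λ.saturated_of_odd hp2 W' D' hopt)

/-- **Abbes–Ullmo's Thm. A at ODD `p ∤ N'` "est contenu dans les travaux de Mazur"** (op. cit.
p. 269): `p ∤ N' ⇒ p² ∤ N'`, so the previous theorem applies. Conditional on
`nonempty_neronFormsAt`. [cite: AbbesUllmo1996, Thm. A and p. 269] -/
theorem not_dvd_maninConstant_of_odd_of_not_dvd_level_of_neronFormsAt (h : nonempty_neronFormsAt)
    (W' : WeierstrassCurve ℚ) [W'.IsElliptic] [W'.IsGloballyMinimal] {N' : ℕ} [NeZero N']
    (D' : ModularParametrizationData W' N')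
    (hopt : ∀ z ∈ D'.L.lattice, ∃ w ∈ periodLattice D'.f, z = D'.c * w) {p : ℕ} (hp : p.Prime)
    (hp2 : p ≠ 2) (hpN : ¬ p ∣ N') : ¬ (p : ℤ) ∣ D'.maninConstant :=
  mazur_not_dvd_maninConstant_of_odd_of_neronFormsAt h W' D' hopt p hp hp2
    fun h2 ↦ hpN (dvd_trans (dvd_pow_self p two_ne_zero) h2)

/-! ### §3 Abbes–Ullmo 1996, Thm. A, and Per2 -/

/-- **Abbes–Ullmo 1996, Thm. A, from the lattice of Néron differentials, Ribet's `deg φ ∣ r` and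
the finiteness of the congruence number.** For `p ∤ N'`, `Λ = S₂(Γ₀(N'); ℤ_(p))`
(`mem_of_not_dvd_level`, §2.1 (2)) and `φ₁^*(Λ) ⊆ ℤ_(p) α_E` (`pullback_integral`, (6) p. 275)
give the displayed hypothesis `hI` of
`abbesUllmo_not_dvd_maninConstant_of_not_dvd_level_of_ribet_of_pullbackIntegral` (Prop. 3.3–3.4),
which with Lemme 3.2 (iii) (`hR`, tree fact `modularDegree_dvd_congruenceNumber`) and `r ≠ 0`
(`hr`, "l'entier positif" p. 276) is the printed proof of Thm. A (p. 279). Conditional; nothing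
is discharged. [cite: AbbesUllmo1996, §2.1 (2), Lemme 3.1–3.2, (6), Prop. 3.3, Prop. 3.4, Preuve du Thm. A (pp. 271–279)] -/
theorem abbesUllmo_not_dvd_maninConstant_of_not_dvd_level_of_ribet_of_neronFormsAt
    (hR : modularDegree_dvd_congruenceNumber)
    (hr : ∀ (W' : WeierstrassCurve ℚ) [W'.IsElliptic] [W'.IsGloballyMinimal] {N' : ℕ} [NeZero N']
      (D' : ModularParametrizationData W' N'),
      (∀ z ∈ D'.L.lattice, ∃ w ∈ periodLattice D'.f, z = D'.c * w) → congruenceNumber D'.f ≠ 0)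
    (h : nonempty_neronFormsAt) :
    abbesUllmo_not_dvd_maninConstant_of_not_dvd_level :=
  abbesUllmo_not_dvd_maninConstant_of_not_dvd_level_of_ribet_of_pullbackIntegral hR
    fun W' _ _ N' _ D' hopt ↦ ⟨hr W' D' hopt, fun p hp hpN ↦ by
      obtain ⟨Λ⟩ := h N' p hp fun h2 ↦ hpN (dvd_trans (dvd_pow_self p two_ne_zero) h2)
      exact Λ.pullback_integral_of_not_dvd_level hpN W' D' hopt⟩

/-- **Per2 from the lattice of Néron differentials** (road (a) of
`ModularCurvePeriodRatioTwoProofs`): the period unit at `p = 2`,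
`realPeriodRat_eq_unit_mul_plusPeriod_two`, from Abbes–Ullmo's Thm. A as derived above
(`SkinnerUrban2014.realPeriodRat_eq_unit_mul_plusPeriod_two_fact_of_abbesUllmo`). Conditional on
`hR`, `hr`, `nonempty_neronFormsAt`; nothing is discharged.
[cite: AbbesUllmo1996, Thm. A (p. 269)] [cite: GreenbergVatsal2000, Rem. 3.4] -/
theorem realPeriodRat_eq_unit_mul_plusPeriod_two_of_ribet_of_neronFormsAt
    (hR : modularDegree_dvd_congruenceNumber)
    (hr : ∀ (W' : WeierstrassCurve ℚ) [W'.IsElliptic] [W'.IsGloballyMinimal] {N' : ℕ} [NeZero N']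
      (D' : ModularParametrizationData W' N'),
      (∀ z ∈ D'.L.lattice, ∃ w ∈ periodLattice D'.f, z = D'.c * w) → congruenceNumber D'.f ≠ 0)
    (h : nonempty_neronFormsAt) :
    realPeriodRat_eq_unit_mul_plusPeriod_two :=
  SkinnerUrban2014.realPeriodRat_eq_unit_mul_plusPeriod_two_fact_of_abbesUllmo
    (abbesUllmo_not_dvd_maninConstant_of_not_dvd_level_of_ribet_of_neronFormsAt hR hr h)

/-! ### §4 Raynaud's letter: `v₂(c) ≤ 1` for `4 ∤ N`, and `2 ∤ c` in the supersingular case -/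

/-- **Mazur–Raynaud (Abbes–Ullmo 1996, Prop. 3.1): `v₂(c_E) ≤ 1` when `4 ∤ N`.** For a globally
minimal `W'` with a lattice-optimal datum `D'` at a level `N'` with `4 ∤ N'`:
`v₂(D'.maninConstant) ≤ 1` — from `c f ∈ Λ`, two turns of the `q`-expansion crank and
`half_saturated_two` (Raynaud's Thm. A.1: `α_E = 2^r β`, `r ≤ 1`). Conditional on
`nonempty_neronFormsAt`. [cite: AbbesUllmo1996, Prop. 3.1 (pp. 274–275), Appendice Thm. A.1 (pp. 279–280)] -/
theorem padicValInt_two_maninConstant_le_one_of_neronFormsAt (h : nonempty_neronFormsAt)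
    (W' : WeierstrassCurve ℚ) [W'.IsElliptic] [W'.IsGloballyMinimal] {N' : ℕ} [NeZero N']
    (D' : ModularParametrizationData W' N')
    (hopt : ∀ z ∈ D'.L.lattice, ∃ w ∈ periodLattice D'.f, z = D'.c * w) (h4 : ¬ 2 ^ 2 ∣ N') :
    padicValInt 2 D'.maninConstant ≤ 1 := by
  by_contra hlt
  replace hlt : 2 ≤ padicValInt 2 D'.maninConstant := by omega
  obtain ⟨Λ⟩ := h N' 2 Nat.prime_two h4
  have hc0 : D'.maninConstant ≠ 0 := D'.maninConstant_ne_zero_holds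
  -- `4 ∣ c`
  have h4c : ((2 : ℕ) : ℤ) ^ 2 ∣ D'.maninConstant :=
    (padicValInt_dvd_iff (p := 2) 2 D'.maninConstant).mpr (Or.inr hlt)
  obtain ⟨c', hc'⟩ := h4c
  have hc'0 : c' ≠ 0 := by
    rintro rfl
    exact hc0 (by rw [hc', mul_zero])
  -- two turns of the crank: `c f ∈ Λ ⇒ (2c') f ∈ Λ ⇒ c' f ∈ Λ`
  have h1 : ((2 * c' : ℤ) : ℂ) • D'.f ∈ Λ.lattice :=
    Λ.intCast_smul_f_mem_of_dvd Nat.prime_two D' (Λ.maninConstant_smul_mem W' D' hopt) (2 * c')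
      (by rw [hc']; push_cast; ring)
  have h2 : (c' : ℂ) • D'.f ∈ Λ.lattice :=
    Λ.intCast_smul_f_mem_of_dvd Nat.prime_two D' h1 c' (by push_cast; ring)
  obtain ⟨t, ht, hct⟩ := Λ.half_saturated_two rfl W' D' hopt (c' : ℂ) h2
  -- `c' = t c = 4 t c'`, so `4 t = 1`, `v₂(t) = -2 < -1`
  have ht4 : t * 4 = 1 := by
    have e1 : (c' : ℂ) = (t : ℂ) * 4 * (c' : ℂ) := by
      calc (c' : ℂ) = (t : ℂ) * (D'.maninConstant : ℂ) := hct
        _ = (t : ℂ) * 4 * (c' : ℂ) := by rw [hc']; push_cast; ring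
    have e2 : (c' : ℚ) = t * 4 * c' := by exact_mod_cast e1
    have hc'Q : (c' : ℚ) ≠ 0 := by exact_mod_cast hc'0
    exact mul_right_cancel₀ hc'Q ((one_mul (c' : ℚ)).trans e2).symm
  have htinv : t = (4 : ℚ)⁻¹ := eq_inv_of_mul_eq_one_left ht4
  have h4v : padicValRat 2 (4 : ℚ) = 2 := by
    rw [show (4 : ℚ) = ((2 ^ 2 : ℕ) : ℚ) by norm_num, padicValRat.of_nat, padicValNat.prime_pow]
    rfl
  rw [htinv, padicValRat.inv, h4v] at ht
  norm_num at ht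

/-- **Raynaud's letter, supersingular case: the Manin constant of a strong Weil curve with good
supersingular reduction at `2` is odd** — the displayed input `hMR` of
`exists_unit_mul_plusPeriod_two_of_goodSupersingular_of_maninConstant_odd` — from `c f ∈ Λ`, the
`q`-expansion crank and `saturated_two_of_supersingular` (Cor. A.4 with Thm. A.1: `Lie(𝒥) → Lie(ℰ)`
onto, `r = 0`; good reduction at `2` gives `2 ∤ N'`, hence `4 ∤ N'`). Conditional on
`nonempty_neronFormsAt`. [cite: AbbesUllmo1996, Prop. 3.1 (p. 274), Appendice Thm. A.1, Cor. A.3 (ii), Cor. A.4 (pp. 279–285)] -/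
theorem maninConstant_odd_of_goodSupersingular_of_neronFormsAt (h : nonempty_neronFormsAt)
    (W₀ : WeierstrassCurve ℚ) [W₀.IsElliptic] [W₀.IsGloballyMinimal]
    (hgood : W₀.HasGoodReductionAtPrime 2) (hss : (2 : ℤ) ∣ W₀.frobeniusTrace 2) {N₀ : ℕ}
    [NeZero N₀] (D₀ : ModularParametrizationData W₀ N₀)
    (hopt : ∀ z ∈ D₀.L.lattice, ∃ w ∈ periodLattice D₀.f, z = D₀.c * w) :
    ¬ (2 : ℤ) ∣ D₀.maninConstant := by
  have h2N : ¬ 2 ∣ N₀ := SkinnerUrban2014.not_dvd_level_of_hasGoodReductionAtPrime hgood D₀.isNewformOf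
  obtain ⟨Λ⟩ := h N₀ 2 Nat.prime_two fun h4 ↦ h2N (dvd_trans (dvd_pow_self 2 two_ne_zero) h4)
  exact_mod_cast Λ.not_dvd_maninConstant_of_saturated Nat.prime_two D₀
    (Λ.maninConstant_smul_mem W₀ D₀ hopt)
    (Λ.saturated_two_of_supersingular rfl W₀ D₀ hopt hgood hss)

/-- **Per2 on the supersingular habitat WITHOUT Ribet's theorem** (road (b) of
`ModularCurvePeriodRatioTwoProofs`): for a globally minimal elliptic `W/ℚ` with good supersingular
reduction at `2`, `E[2]` irreducible and newform `f`, `Ω(W) = u·Ω⁺_f` with `‖u‖₂ = 1` — from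
`nonempty_neronFormsAt` alone, via `maninConstant_odd_of_goodSupersingular_of_neronFormsAt` and
`exists_unit_mul_plusPeriod_two_of_goodSupersingular_of_maninConstant_odd`. Conditional; nothing
is discharged. [cite: AbbesUllmo1996, Prop. 3.1 (p. 274), Appendice Cor. A.4 (p. 285)]
[cite: GreenbergVatsal2000, Rem. 3.4] -/
theorem exists_unit_mul_plusPeriod_two_of_goodSupersingular_of_neronFormsAt
    (h : nonempty_neronFormsAt) (W : WeierstrassCurve ℚ) [W.IsElliptic] [W.IsGloballyMinimal]
    (hgood : W.HasGoodReductionAtPrime 2) (hss : (2 : ℤ) ∣ W.frobeniusTrace 2)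
    (hirr : W.HasIrreducibleModPGaloisRep 2) {N : ℕ} [NeZero N] (f : CuspForm (Gamma0 N) 2)
    (hf : IsNewformOf W f) :
    ∃ u : ℚ, ‖(u : ℚ_[2])‖ = 1 ∧ W.realPeriodRat = u * plusPeriod f :=
  exists_unit_mul_plusPeriod_two_of_goodSupersingular_of_maninConstant_odd
    (fun W₀ _ _ hgood₀ hss₀ _ _ D₀ hopt₀ ↦
      maninConstant_odd_of_goodSupersingular_of_neronFormsAt h W₀ hgood₀ hss₀ D₀ hopt₀)
    W hgood hss hirr f hf

end Literature.NumberTheory.EllipticCurves.ModularForms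

end
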